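import Literature.NumberTheory.EllipticCurves.TorsionFrobeniusWeilPairingAnnihilatorProofs
import Mathlib.LinearAlgebra.Dimension.Finite
import HarnessLib

/-!
# `#ker(Frob − q | E[m]) ≤ #ker(Frob − 1 | E[m]) = #E(K_w)[m]` at a place `w ∤ m` — PROVED
# (annihilators under a non-degenerate pairing are bounded by Dedekind's independence of characters)

Topic `NumberTheory/EllipticCurves`; namespace `WeierstrassCurve` (generic §1–§2 in
`Literature.NumberTheory.EllipticCurves`). THEOREMS ONLY (no definition, no named fact, no instance,
no `sorry`; D-0026). Cell `bsd-stepL` (typer lane `defn-ty1`, g9): the COUNT completing the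
Weil-pairing step (`TorsionFrobeniusWeilPairingAnnihilatorProofs`) of module L4a of the discharge plan
for `JetchevSkinnerWan2017.sigmaLocal_charIdeal_eulerFactor_mem_of_noTamagawaDefect`
(`HOME/defn-ty1/g9/NOTE-sigmaLocal-discharge-plan-defn-ty1-g9.md`): local Tate duality for the finite
module `E[m]` at `w ∤ m` in the numerical form `#E[m](−1)^{Frob=1} ≤ #E[m]^{Frob=1}` (in fact `=`).

## What is proved

* §1 `natCard_monoidHom_le` — **Dedekind**: a finite group has at most `#G` homomorphisms into the
  multiplicative group of a field (`linearIndependent_monoidHom`: distinct characters are linearly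
  independent in the `#G`-dimensional space of functions);
* §2 `natCard_annihilator_le` — for a finite abelian group `M`, a field `L`, a bi-additive pairing
  `e : M × M → L` with non-zero values and trivial right kernel, and a subgroup `B ≤ M`: the right
  annihilator `B^⊥ = {T | ∀ b ∈ B, e(b, T) = 1}` has `#B^⊥ ≤ #(M/B)` (`T ↦ e(·, T)` embeds `B^⊥` into
  `Hom(M/B, Lˣ)`); `natCard_quotient_range_eq_natCard_ker` — `#(M/α(M)) = #ker α` for an endomorphism;
* §3 **`natCard_smul_eq_natCast_smul_le_natCard_fixed`** — for an elliptic curve `W/K`, a finite place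
  `w`, `m ≥ 2` with `char k_w ∤ m`, and the restriction `g` of any arithmetic Frobenius lift at `w`:
  `#{T ∈ E[m] | g T = q_w T} ≤ #{T ∈ E[m] | g T = T}` — with the Weil pairing
  (`exists_weilPairing_smul_eq_natCast_smul_iff`: `ker(g − q) = ((g − 1)E[m])^⊥`).

HONEST FRAMING: finite level only; nothing about `H¹` or `E[p^∞]`; the named fact is NOT discharged.

References: [MilneADT2006] I Cor. 2.3 (local duality for finite modules), I Thm. 2.8; [SilvermanAEC2009]
III.8.1; [GreenbergLNM1716] §2; E. Artin, *Galois Theory* (Dedekind's lemma) via Mathlib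
`linearIndependent_monoidHom`.
-/

noncomputable section

open scoped Classical
open Field ValuativeRel NumberField IsDedekindDomain IsDedekindDomain.HeightOneSpectrum
open Literature.NumberTheory.EllipticCurves Literature.NumberTheory.GaloisRepresentations
  Literature.NumberTheory.GaloisRepresentations.IsNonarchimedeanLocalField

/-! ## §1 Dedekind: `#Hom(G, Lˣ) ≤ #G` -/

namespace Literature.NumberTheory.EllipticCurves

/-- **Dedekind's independence of characters, numerically**: a finite group `G` admits at most `#G`
homomorphisms into (the multiplicative monoid of) a field `L` — they are linearly independent in the
`L`-vector space of functions `G → L`, of dimension `#G` (Mathlib `linearIndependent_monoidHom`).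
[cite: MilneFT2022, Ch. 5 (Dedekind's theorem on the independence of characters, Thm. 5.14)] -/
theorem natCard_monoidHom_le (G : Type*) [Group G] [Finite G] (L : Type*) [Field L] :
    Nat.card (G →* L) ≤ Nat.card G := by
  have hli := linearIndependent_monoidHom G L
  haveI : Finite (G →* L) := hli.finite
  letI : Fintype (G →* L) := Fintype.ofFinite _
  letI : Fintype G := Fintype.ofFinite _
  have h := hli.fintype_card_le_finrank
  rw [Module.finrank_fintype_fun_eq_card] at h
  rwa [Nat.card_eq_fintype_card, Nat.card_eq_fintype_card]

/-! ## §2 Annihilators under a pairing with trivial right kernel -/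

section Pairing

variable {M : Type*} [AddCommGroup M] [Finite M] {L : Type*} [Field L] (e : M → M → L)
  (hne : ∀ S T, e S T ≠ 0)
  (haddl : ∀ S₁ S₂ T, e (S₁ + S₂) T = e S₁ T * e S₂ T)
  (haddr : ∀ S T₁ T₂, e S (T₁ + T₂) = e S T₁ * e S T₂)
  (hnd : ∀ T, (∀ S, e S T = 1) → T = 0)

include hne haddl in
omit [Finite M] in
/-- `e(0, T) = 1`. [folklore] -/
private theorem pairing_zero_left (T : M) : e 0 T = 1 := by
  have h := haddl 0 0 T
  rw [add_zero] at h
  exact (mul_eq_left₀ (hne 0 T)).1 h.symm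

include hne haddr in
omit [Finite M] in
/-- `e(S, T) = e(S, T')` for all `S` forces `e(S, T − T') = 1` for all `S`. [folklore] -/
private theorem pairing_sub_eq_one {T T' : M} (h : ∀ S, e S T = e S T') (S : M) : e S (T - T') = 1 := by
  have h1 : e S (T - T' + T') = e S (T - T') * e S T' := haddr S _ _
  rw [sub_add_cancel, h S] at h1
  exact ((mul_eq_right₀ (hne S T')).1 h1.symm)

include hne haddl haddr hnd in
/-- **`#B^⊥ ≤ #(M/B)`** for the right annihilator `B^⊥ = {T | ∀ b ∈ B, e(b, T) = 1}` of a subgroup `B`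
under a bi-additive pairing `e : M × M → L` (field `L`) with non-zero values and trivial right kernel:
`T ↦ e(·, T)` is an injection `B^⊥ ↪ Hom(M/B, Lˣ) ⊆ Hom(M/B, L)`, and Dedekind bounds the latter by
`#(M/B)`. [cite: MilneADT2006, I §0 (pairings of finite groups: "the annihilator of B has order [M : B]")] -/
theorem natCard_annihilator_le (B : AddSubgroup M) :
    Nat.card {T : M // ∀ b ∈ B, e b T = 1} ≤ Nat.card (M ⧸ B) := by
  haveI : Finite (M ⧸ B) := Finite.of_surjective _ (QuotientAddGroup.mk_surjective (s := B))
  -- the additive character `S ↦ e(S, T)` with values in `Lˣ`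
  let f : M → (M →+ Additive Lˣ) := fun T ↦
    { toFun := fun S ↦ Additive.ofMul (Units.mk0 (e S T) (hne S T))
      map_zero' := by
        apply Additive.toMul.injective
        exact Units.ext (by simp [pairing_zero_left e hne haddl T])
      map_add' := fun S₁ S₂ ↦ by
        apply Additive.toMul.injective
        exact Units.ext (by simp [haddl]) }
  have hf : ∀ T S, ((f T S).toMul : L) = e S T := fun _ _ ↦ rfl
  have hker : ∀ T : {T : M // ∀ b ∈ B, e b T = 1}, B ≤ (f T.1).ker := fun T b hb ↦ by
    rw [AddMonoidHom.mem_ker]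
    apply Additive.toMul.injective
    exact Units.ext (by rw [hf]; exact T.2 b hb)
  -- descend to `M ⧸ B` and view as a monoid homomorphism `Multiplicative (M ⧸ B) →* L`
  let Ψ : {T : M // ∀ b ∈ B, e b T = 1} → (Multiplicative (M ⧸ B) →* L) := fun T ↦
    (Units.coeHom L).comp (AddMonoidHom.toMultiplicativeLeft (QuotientAddGroup.lift B (f T.1) (hker T)))
  have hΨ : ∀ (T : {T : M // ∀ b ∈ B, e b T = 1}) (S : M),
      Ψ T (Multiplicative.ofAdd (QuotientAddGroup.mk S)) = e S T.1 := fun T S ↦ by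
    change ((AddMonoidHom.toMultiplicativeLeft (QuotientAddGroup.lift B (f T.1) (hker T))
      (Multiplicative.ofAdd (QuotientAddGroup.mk S)) : Lˣ) : L) = e S T.1
    rw [AddMonoidHom.coe_toMultiplicativeLeft]
    change (((QuotientAddGroup.lift B (f T.1) (hker T)) (QuotientAddGroup.mk S)).toMul : L) = _
    rw [QuotientAddGroup.lift_mk]
    rfl
  have hinj : Function.Injective Ψ := by
    intro T T' h
    apply Subtype.ext
    have h' : ∀ S, e S T.1 = e S T'.1 := fun S ↦ by
      rw [← hΨ T S, ← hΨ T' S, h]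
    have := hnd _ (pairing_sub_eq_one e hne haddr h')
    rwa [sub_eq_zero] at this
  haveI : Finite (Multiplicative (M ⧸ B) →* L) := (linearIndependent_monoidHom _ L).finite
  calc Nat.card {T : M // ∀ b ∈ B, e b T = 1}
      ≤ Nat.card (Multiplicative (M ⧸ B) →* L) := Nat.card_le_card_of_injective Ψ hinj
    _ ≤ Nat.card (Multiplicative (M ⧸ B)) := natCard_monoidHom_le _ L
    _ = Nat.card (M ⧸ B) := Nat.card_congr Multiplicative.toAdd

end Pairing

/-- **`#(M/α(M)) = #ker α`** for an endomorphism `α` of a finite abelian group (first isomorphism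
theorem and Lagrange: "for a finite module, the kernel and cokernel of an endomorphism have the same
order", the Herbrand-quotient bookkeeping of [MilneADT2006] I §0).
[cite: MilneADT2006, I §0 (finite modules: #ker = #coker for an endomorphism; used in the proof of Thm. 2.8)] -/
theorem natCard_quotient_range_eq_natCard_ker {M : Type*} [AddCommGroup M] [Finite M] (α : M →+ M) :
    Nat.card (M ⧸ α.range) = Nat.card α.ker := by
  have h1 := AddSubgroup.card_eq_card_quotient_mul_card_addSubgroup α.ker
  have h2 := AddSubgroup.card_eq_card_quotient_mul_card_addSubgroup α.range
  rw [Nat.card_congr (QuotientAddGroup.quotientKerEquivRange α).toEquiv] at h1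
  have hpos : 0 < Nat.card α.range := Nat.card_pos
  have h3 : Nat.card α.range * Nat.card α.ker = Nat.card (M ⧸ α.range) * Nat.card α.range := by
    rw [← h1, ← h2]
  rw [mul_comm] at h3
  exact (Nat.eq_of_mul_eq_mul_right hpos h3).symm

end Literature.NumberTheory.EllipticCurves

/-! ## §3 `#ker(g − q | E[m]) ≤ #ker(g − 1 | E[m])` -/

namespace WeierstrassCurve

variable {K : Type} [Field K] [NumberField K] (W : WeierstrassCurve K) [W.IsElliptic]
  {w : HeightOneSpectrum (𝓞 K)}

/-- **`#ker(g − q_w | E[m]) ≤ #ker(g − 1 | E[m])`** for an elliptic curve `W` over a number field `K`, a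
finite place `w`, an integer `m ≥ 2` with `char k_w ∤ m`, and `g = absGaloisRestrict K K_w φ` the
restriction of an arithmetic Frobenius lift: by the Weil pairing `ker(g − q_w)` is the right
annihilator of `(g − 1)E[m]` (`exists_weilPairing_smul_eq_natCast_smul_iff`), whose order is at most
`#(E[m]/(g − 1)E[m]) = #ker(g − 1 | E[m])` (`natCard_annihilator_le`, `natCard_quotient_range_eq_natCard_ker`)
— the numerical local duality `#E[m](−1)^{Frob = 1} ≤ #E[m]^{Frob = 1} = #E(K_w)[m]`.
[cite: MilneADT2006, I Cor. 2.3] [cite: SilvermanAEC2009, Prop. III.8.1] [cite: GreenbergLNM1716, §2 (p. 71)] -/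
theorem natCard_smul_eq_natCast_smul_le_natCard_fixed {m : ℕ} (h2m : 2 ≤ m)
    (hm : ¬ ringChar 𝓀[w.adicCompletion K] ∣ m)
    {φ : absoluteGaloisGroup (w.adicCompletion K)} (hφ : IsFrobPow φ 1) :
    Nat.card {T : geomTorsion W m //
        absGaloisRestrict K (w.adicCompletion K) φ • T = residueFieldCard (w.adicCompletion K) • T} ≤
      Nat.card {T : geomTorsion W m // absGaloisRestrict K (w.adicCompletion K) φ • T = T} := by
  have hm0 : m ≠ 0 := by omega
  haveI : Finite (geomTorsion W m) :=
    finite_torsionPoints_holds W (AlgebraicClosure K) (n := (m : ℤ)) (by exact_mod_cast hm0)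
  obtain ⟨e, hμ, haddl, haddr, -, hnd, -, hiff⟩ := W.exists_weilPairing_smul_eq_natCast_smul_iff h2m hm hφ
  set g := absGaloisRestrict K (w.adicCompletion K) φ with hg
  have hne : ∀ S T, e S T ≠ 0 := fun S T h0 ↦ by
    have h := hμ S T
    rw [h0, zero_pow hm0] at h
    exact zero_ne_one h
  -- `α = g − 1` as an endomorphism of `E[m]`
  let α : geomTorsion W m →+ geomTorsion W m :=
    DistribSMul.toAddMonoidHom (geomTorsion W m) g - AddMonoidHom.id _
  have hα : ∀ S, α S = g • S - S := fun S ↦ rfl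
  -- `ker(g − q) ≃ (range α)^⊥`
  have h1 : Nat.card {T : geomTorsion W m // g • T = residueFieldCard (w.adicCompletion K) • T} =
      Nat.card {T : geomTorsion W m // ∀ b ∈ α.range, e b T = 1} := by
    refine Nat.card_congr (Equiv.subtypeEquivRight fun T ↦ ?_)
    rw [hiff T]
    constructor
    · rintro h b ⟨S, rfl⟩
      rw [hα]; exact h S
    · intro h S
      have := h (α S) ⟨S, rfl⟩
      rwa [hα] at this
  -- `ker(g − 1) = ker α`
  have h2 : Nat.card {T : geomTorsion W m // g • T = T} = Nat.card α.ker := by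
    refine Nat.card_congr (Equiv.subtypeEquivRight fun T ↦ ?_)
    rw [AddMonoidHom.mem_ker, hα, sub_eq_zero]
  rw [h1, h2, ← natCard_quotient_range_eq_natCard_ker α]
  exact natCard_annihilator_le e hne haddl haddr hnd α.range

end WeierstrassCurve

end
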